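import Summits.FinalStateConjecture.FinalStateConjecture.Theorems.PhotonSphereChannelsChannelsResolveTameDevelopmentsRFutureEscapingPaths
import Literature.Geometry.Lorentzian.BackgroundChartCalculusLocal
import HarnessLib

/-!
# Crux `ChannelsResolveTameDevelopmentsR` (K2R-T2, stmt-FinalStateConjecture-17430), line `dark-future-exactness`,
# stub T `stub_tameEndgame` — its closed pieces: the orientation clause is automatic on the dispersive branch
# in EVERY Cauchy development; no dust at `N = 0`; hypothesis (a) has content iff the outer region is nonempty

Stub T (skeleton `Cruxes/ChannelsResolveTameDevelopmentsR/Lines/dark_future_exactness.lean`) concludes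
`∃ O d, O = exteriorOf 𝒟 d.charted ∧ HasExhaustiveCharts d ∧ IsFutureOriented d` from the hull hypotheses
(a)–(d); the transfer "hull ⇒ charts" is XL (typed missing facts in the lead's `work/stubs/stub_tameEndgame.md`).
Landed here (sorry-free, no named facts):
* §2 **`flatChart_eventually_isFutureDirected`** — for EVERY Cauchy development (no vacuum, maximality or
  complete `𝓘⁺`), every `O ⊆ J⁺(ι X)` and every hole-free (`d.N = 0`) decomposition `d` of `O` in any `Cᵏ`:
  eventually in flat time `dΨ₀(∂₀)` is future-directed on the flat slab (`Negative/SubMinkowskiOrientation`'s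
  paper remark made a theorem: uniform timelikeness from `C⁰` slab convergence; were `dΨ₀(∂₀)` past-directed at
  every late point, time-reversed vertical chart lines would be future timelike curves in `J⁺(ι X)` of unbounded
  length into a fixed event, against `TrappedSet.exists_lorentzDist_le_of_isCompact`; one sign on `{x⁰ > τ₁}`).
* §3 `isFutureOriented_of_N_eq_zero(_of_exteriorOf)`, `stub_tameEndgame_closedPieces` (registered sub-goal) — on the DISPERSIVE
  branch of T, `IsFutureOriented d` is implied by honesty `O = exteriorOf 𝒟 d.charted`: T's `N = 0` target is
  verbatim the pre-T2 target `O = exteriorOf ∧ HasExhaustiveCharts`.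
* §4 `image_timeSlab_eq_of_N_eq_zero`, `deviationCk_flat_eq_of_N_eq_zero` — no dust at `N = 0`: the late flat
  slabs ARE the entire hyperplanes `{x⁰ = τ} ≅ ℝ³` (the target needs a quasi-flat Minkowski half-space inside
  `J⁺(ι X)`; it is not cheaply witnessable).
* §5 `exists_isFutureEscaping_iff_outerRegion_nonempty` — hypothesis (a) `OuterHullExists` of T ranges over a
  nonempty set of sequences iff the outer region is nonempty (`exists_isFutureEscapingPath`, p118990); on the
  fibre `outerRegion 𝒟 = ∅` all of (a)–(d) are vacuous.

References: B. O'Neill, *Semi-Riemannian geometry*, Academic Press 1983, Ch. 5 p. 145, Ch. 14 Def. 14.15,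
Lemma 14.21 [ONeillSemiRiemannian1983]; M. Dafermos, I. Rodnianski, arXiv:0811.0354, §5.1 [arXiv08110354];
DHRT arXiv:2104.08222, §1 [arXiv210408222]; M. Dafermos, J. Luk, arXiv:1710.01722, Conjecture 1 [DafermosLuk2017].
-/

noncomputable section

-- the operator-norm instance on `E4 →L[ℝ] E4 →L[ℝ] ℝ` needs one more level of pending
-- instance problems than the default (as in `PhotonSphereChannelsKerrDevDefs.lean`)
set_option maxSynthPendingDepth 3
-- every `Summit.FinalStateConjecture.FinalStateConjecture.…` name repeats the summit = sub-problem segment (D-0017 layout)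
set_option linter.dupNamespace false

open Set Filter Function TopologicalSpace Manifold Bundle MeasureTheory
open scoped Topology Manifold ContDiff ENNReal NNReal

namespace Summit.FinalStateConjecture.FinalStateConjecture.Theorems.DarkFuture

open Literature.Geometry.Lorentzian
open Summit.FinalStateConjecture.FinalStateConjecture.Theorems.TameHull

/-! ### §1 Generic tools -/

section ArcLength
variable {E : Type*} [NormedAddCommGroup E] [NormedSpace ℝ E] {H : Type*} [TopologicalSpace H]
  {I : ModelWithCorners ℝ E H} {n : ℕ∞ω} {M : Type*} [TopologicalSpace M] [ChartedSpace H M]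
  [IsManifold I ∞ M] {g : PseudoRiemannianMetric I n E (TangentSpace I : M → Type _)}

/-- **Arc length of a segment of speed `≥ c`**: if `c ≤ |γ'(t)|` on `[a, b]` (`a ≤ b`, `0 ≤ c`) then
`c · (b − a) ≤ L(γ|[a, b])` (monotonicity of the integral). O'Neill 1983, Ch. 5, Def. 5.11.
[cite: ONeillSemiRiemannian1983, Ch. 5, Def. 5.11 (pp. 131–132)] -/
theorem ofReal_mul_sub_le_arcLength {γ : ℝ → M} {a b c : ℝ} (hc : 0 ≤ c)
    (h : ∀ t ∈ Icc a b, c ≤ g.speed γ t) :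
    ENNReal.ofReal (c * (b - a)) ≤ g.arcLength γ a b := by
  rw [PseudoRiemannianMetric.arcLength_eq_lintegral_Icc]
  calc ENNReal.ofReal (c * (b - a)) = ∫⁻ _ in Icc a b, ENNReal.ofReal c := by
        rw [setLIntegral_const, Real.volume_Icc, ← ENNReal.ofReal_mul hc]
    _ ≤ ∫⁻ t in Icc a b, ENNReal.ofReal (g.speed γ t) :=
        setLIntegral_mono' measurableSet_Icc fun t ht ↦ ENNReal.ofReal_le_ofReal (h t ht)

end ArcLength

universe u

/-- For a curve in the model vector space `E4`, the manifold velocity is the ordinary derivative. [folklore] -/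
private theorem velocity_eq_deriv (c : ℝ → E4) (s : ℝ) : (velocity 𝓘(ℝ, E4) c s : E4) = deriv c s := by
  change mfderiv 𝓘(ℝ, ℝ) 𝓘(ℝ, E4) c s (1 : ℝ) = deriv c s
  rw [mfderiv_eq_fderiv]
  rfl

/-- **Point control from slab control**: if the `Cᵏ` slab deviation at time `τ` is `< ε`, the operator norm of
the deviation is `< ε` at every point of the slab (the `m = 0` term of `supCkENorm`). [cite: arXiv210408222, §1] -/
theorem norm_deviation_lt_of_deviationCk_lt (𝓢 : Spacetime.{u} 4) {B : ModelBackground}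
    (Ψ : B.domain → 𝓢.carrier) {k : ℕ} {τ ε : ℝ} (hε : 0 < ε)
    (h : 𝓢.deviationCk B Ψ k τ < ENNReal.ofReal ε) {x : B.domain} (hx : x ∈ B.timeSlab τ) :
    ‖𝓢.deviation B Ψ x‖ < ε := by
  have h' : supCkENorm (Subtype.val '' B.timeSlab τ) k (𝓢.deviationExtend B Ψ) < ENNReal.ofReal ε := h
  have h1 := enorm_iteratedFDeriv_le_supCkENorm (S := Subtype.val '' B.timeSlab τ) (k := k) (m := 0)
    (Nat.zero_le k) (x := (x : E4)) (mem_image_of_mem _ hx) (𝓢.deviationExtend B Ψ)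
  rw [← ofReal_norm, norm_iteratedFDeriv_zero, Spacetime.deviationExtend_coe] at h1
  exact (ENNReal.ofReal_lt_ofReal_iff hε).1 (h1.trans_lt h')

/-- **Uniform timelike bound**: if the deviation of `Ψ` from the flat background at `x` has operator norm
`≤ 1/(2(‖∂₀‖² + 1))`, then `g(dΨ ∂₀, dΨ ∂₀) = −1 + (Ψ^*g − η)(∂₀, ∂₀) ≤ −1/2`. [cite: ONeillSemiRiemannian1983, Ch. 5, p. 145] -/
theorem metric_mfderiv_basisVector_le (𝓢 : Spacetime.{u} 4) {V : Opens E4}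
    (Ψ : (Minkowski.backgroundOn V).domain → 𝓢.carrier) (x : (Minkowski.backgroundOn V).domain)
    (hd : ‖𝓢.deviation (Minkowski.backgroundOn V) Ψ x‖ ≤ 1 / (2 * (‖E4.basisVector (0 : Fin 4)‖ ^ 2 + 1))) :
    𝓢.metric.val (Ψ x) (mfderiv 𝓘(ℝ, E4) (𝓡 4) Ψ x (E4.basisVector 0))
      (mfderiv 𝓘(ℝ, E4) (𝓡 4) Ψ x (E4.basisVector 0)) ≤ -(1 / 2) := by
  set u : E4 := E4.basisVector 0 with hu
  have happ := 𝓢.deviation_apply (Minkowski.backgroundOn V) Ψ x u u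
  have hb : (Minkowski.backgroundOn V).bilin x.1 u u = -1 := Minkowski.bilin_basisVector_zero
  have hle : |𝓢.deviation (Minkowski.backgroundOn V) Ψ x u u| ≤
      ‖𝓢.deviation (Minkowski.backgroundOn V) Ψ x‖ * ‖u‖ * ‖u‖ := by
    have h1 := (𝓢.deviation (Minkowski.backgroundOn V) Ψ x).le_opNorm₂ u u
    rwa [Real.norm_eq_abs] at h1
  have h2 : ‖𝓢.deviation (Minkowski.backgroundOn V) Ψ x‖ * ‖u‖ * ‖u‖ ≤ 1 / 2 := by
    calc ‖𝓢.deviation (Minkowski.backgroundOn V) Ψ x‖ * ‖u‖ * ‖u‖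
        ≤ 1 / (2 * (‖u‖ ^ 2 + 1)) * ‖u‖ * ‖u‖ := by gcongr
      _ = ‖u‖ ^ 2 / (2 * (‖u‖ ^ 2 + 1)) := by ring
      _ ≤ 1 / 2 := by
          rw [div_le_iff₀ (by positivity)]
          nlinarith [sq_nonneg ‖u‖]
  have habs := (abs_le.1 (hle.trans h2)).2
  rw [happ, hb] at habs
  linarith

/-! ### §2 The flat chart of a hole-free decomposition of a region in `J⁺(ι X)` is eventually future-oriented -/

section Development
variable {X : Type} [TopologicalSpace X] [ChartedSpace E3 X] [IsManifold (𝓡 3) ∞ X]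
  [ConnectedSpace X] {D : InitialDataSet (𝓡 3) X}

/-- `g(-v, -v) = g(v, v)`. [folklore] -/
private theorem val_neg_neg (𝒟 : CauchyDevelopment D) {p : 𝒟.carrier} (v : TangentSpace (𝓡 4) p) :
    𝒟.metric.val p (-v) (-v) = 𝒟.metric.val p v v := by
  rw [(𝒟.metric.val p).map_neg v]
  change -(𝒟.metric.val p v (-v)) = _
  rw [(𝒟.metric.val p v).map_neg v, neg_neg]

/-- **The time-reversed vertical chart line** `C = Ψ ∘ σ ∘ (t ↦ -t)`, `σ s = (max s τ₁, y)` (bent below `τ₁`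
to stay in `U ⊇ {x⁰ ≥ τ₁}`): at every `t` with `-t > τ₁` it is differentiable with velocity `-dΨ(∂₀)`. [folklore] -/
theorem velocity_flatChart_reversedLine (𝒟 : CauchyDevelopment D) {U : Opens E4} (Ψ : U → 𝒟.carrier)
    (hΨ : ∀ x : U, MDifferentiableAt 𝓘(ℝ, E4) (𝓡 4) Ψ x) (y : E3) {τ₁ : ℝ}
    (hmem : ∀ s : ℝ, E4.ofTimeSpace (max s τ₁) y ∈ (U : Set E4)) {t : ℝ} (ht : τ₁ < -t) :
    MDifferentiableAt 𝓘(ℝ, ℝ) (𝓡 4) (Ψ ∘ ((fun s ↦ (⟨E4.ofTimeSpace (max s τ₁) y, hmem s⟩ : U)) ∘ Neg.neg)) t ∧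
      velocity (𝓡 4) (Ψ ∘ ((fun s ↦ (⟨E4.ofTimeSpace (max s τ₁) y, hmem s⟩ : U)) ∘ Neg.neg)) t =
        -(mfderiv 𝓘(ℝ, E4) (𝓡 4) Ψ ⟨E4.ofTimeSpace (max (-t) τ₁) y, hmem (-t)⟩ (E4.basisVector 0)) := by
  set u : E4 := E4.basisVector 0 with hu
  set σ : ℝ → U := fun s ↦ ⟨E4.ofTimeSpace (max s τ₁) y, hmem s⟩ with hσ
  have hline : ∀ t' : ℝ, τ₁ < -t' →
      (Subtype.val ∘ (σ ∘ Neg.neg)) t' = E4.ofTimeSpace 0 y + (-t') • u := by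
    intro t' ht'
    change E4.ofTimeSpace (max (-t') τ₁) y = _
    rw [max_eq_left ht'.le, hu, add_comm]
    exact E4.ofTimeSpace_eq_smul_add (-t') y
  have hopen : IsOpen {t' : ℝ | τ₁ < -t'} := isOpen_lt continuous_const continuous_neg
  have hevq : (Subtype.val ∘ (σ ∘ Neg.neg)) =ᶠ[𝓝 t] fun t' ↦ E4.ofTimeSpace 0 y + (-t') • u := by
    filter_upwards [hopen.mem_nhds ht] with t' ht'
    exact hline t' ht'
  have hderiv : HasDerivAt (fun t' : ℝ ↦ E4.ofTimeSpace 0 y + (-t') • u) (-u) t := by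
    simpa using ((hasDerivAt_neg t).smul_const u).const_add (E4.ofTimeSpace 0 y)
  have hval : HasDerivAt (Subtype.val ∘ (σ ∘ Neg.neg)) (-u) t := hderiv.congr_of_eventuallyEq hevq
  have hσd : MDifferentiableAt 𝓘(ℝ, ℝ) 𝓘(ℝ, E4) (σ ∘ Neg.neg) t :=
    (mdifferentiableAt_subtypeVal_comp_curve_iff U).1
      (mdifferentiableAt_iff_differentiableAt.2 hval.differentiableAt)
  have hσvel : (velocity 𝓘(ℝ, E4) (σ ∘ Neg.neg) t : E4) = -u := by
    rw [← velocity_subtypeVal_comp U (σ ∘ Neg.neg) t, velocity_eq_deriv, hval.deriv]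
  have hΨ' := hΨ (σ (-t))
  have hcomp : MDifferentiableAt 𝓘(ℝ, ℝ) (𝓡 4) (Ψ ∘ (σ ∘ Neg.neg)) t := hΨ'.comp t hσd
  refine ⟨hcomp, ?_⟩
  change mfderiv 𝓘(ℝ, ℝ) (𝓡 4) (Ψ ∘ (σ ∘ Neg.neg)) t (1 : ℝ) = _
  rw [mfderiv_comp t hΨ' hσd]
  change mfderiv 𝓘(ℝ, E4) (𝓡 4) Ψ (σ (-t)) (velocity 𝓘(ℝ, E4) (σ ∘ Neg.neg) t) = _
  rw [hσvel]
  exact (mfderiv 𝓘(ℝ, E4) (𝓡 4) Ψ (σ (-t))).map_neg u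

/-- **No late half-space of past-directed chart time.** For a chart `Ψ : ↥U → 𝒟` of a Cauchy development,
differentiable on `U ⊇ {x⁰ ≥ τ₁}`, mapping `{x⁰ > τ₁}` into `J⁺(ι X)`, with `g(dΨ ∂₀, dΨ ∂₀) ≤ −1/2` there,
`dΨ(∂₀)` is NOT everywhere past-directed on `{x⁰ > τ₁}`: else `t ↦ Ψ(−t, y)` is a future timelike curve of
speed `≥ 1/√2` from `Ψ(S, y) ∈ J⁺(ι X)` to the fixed event `Ψ(τ₁ + 1, y)`, of length `→ ∞` with `S`, against
the bounded time separation of a Cauchy development. [cite: ONeillSemiRiemannian1983, Ch. 14, Def. 14.15 and Lemma 14.21] -/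
theorem not_forall_isPastDirected_of_lateHalfSpace (𝒟 : CauchyDevelopment D) {U : Opens E4}
    (Ψ : U → 𝒟.carrier) (hΨ : ∀ x : U, MDifferentiableAt 𝓘(ℝ, E4) (𝓡 4) Ψ x) {τ₁ : ℝ}
    (hdom : ∀ z : E4, τ₁ ≤ z 0 → z ∈ (U : Set E4))
    (hO : ∀ x : U, τ₁ < (x : E4) 0 → Ψ x ∈ 𝒟.metric.causalFuture 𝒟.timeOrientation (range 𝒟.embed))
    (htl : ∀ x : U, τ₁ ≤ (x : E4) 0 →
      𝒟.metric.val (Ψ x) (mfderiv 𝓘(ℝ, E4) (𝓡 4) Ψ x (E4.basisVector 0))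
        (mfderiv 𝓘(ℝ, E4) (𝓡 4) Ψ x (E4.basisVector 0)) ≤ -(1 / 2)) :
    ¬ ∀ x : U, τ₁ < (x : E4) 0 →
      𝒟.timeOrientation.IsPastDirected (mfderiv 𝓘(ℝ, E4) (𝓡 4) Ψ x (E4.basisVector 0)) := by
  intro hpast
  set u : E4 := E4.basisVector 0 with hu
  -- the vertical line through `(·, y)`, bent to constant time below `τ₁`, read backwards in time
  set y : E3 := 0 with hy
  have hmem : ∀ s : ℝ, E4.ofTimeSpace (max s τ₁) y ∈ (U : Set E4) := fun s ↦
    hdom _ (by rw [E4.ofTimeSpace_apply_zero]; exact le_max_right _ _)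
  set σ : ℝ → U := fun s ↦ ⟨E4.ofTimeSpace (max s τ₁) y, hmem s⟩ with hσ
  have hσ_time : ∀ s, τ₁ < s → τ₁ < ((σ s : U) : E4) 0 := fun s hs ↦ by
    change τ₁ < (E4.ofTimeSpace (max s τ₁) y) 0
    rw [E4.ofTimeSpace_apply_zero]; exact lt_max_of_lt_left hs
  set C : ℝ → 𝒟.carrier := Ψ ∘ (σ ∘ Neg.neg) with hC
  have hvel : ∀ t : ℝ, τ₁ < -t → MDifferentiableAt 𝓘(ℝ, ℝ) (𝓡 4) C t ∧
      velocity (𝓡 4) C t = -(mfderiv 𝓘(ℝ, E4) (𝓡 4) Ψ (σ (-t)) u) := fun t ht ↦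
    velocity_flatChart_reversedLine 𝒟 Ψ hΨ y hmem ht
  -- the reversed line is a future timelike curve on every `[a, b]` with `-b > τ₁`, of speed `≥ √(1/2)`
  have hcurve : ∀ a b : ℝ, τ₁ < -b →
      𝒟.metric.IsFutureTimelikeCurveOn 𝒟.timeOrientation C (Icc a b) := by
    intro a b hb t ht
    have htt : τ₁ < -t := hb.trans_le (by linarith [ht.2])
    obtain ⟨hd, hv⟩ := hvel t htt
    refine ⟨hd, ?_, ?_⟩ <;> rw [hv]
    · exact (𝒟.metric.isTimelike_neg_iff _).2 ((htl _ (hσ_time _ htt).le).trans_lt (by norm_num))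
    · exact (𝒟.timeOrientation.isFutureDirected_neg_iff _).2 (hpast _ (hσ_time _ htt))
  have hspeed : ∀ t : ℝ, τ₁ < -t → Real.sqrt (1 / 2) ≤ 𝒟.metric.speed C t := by
    intro t ht
    obtain ⟨-, hv⟩ := hvel t ht
    have hW := htl _ (hσ_time _ ht).le
    have hneg : 𝒟.metric.val (C t) (velocity (𝓡 4) C t) (velocity (𝓡 4) C t) =
        𝒟.metric.val (Ψ (σ (-t))) (mfderiv 𝓘(ℝ, E4) (𝓡 4) Ψ (σ (-t)) u)
          (mfderiv 𝓘(ℝ, E4) (𝓡 4) Ψ (σ (-t)) u) := by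
      rw [hv]
      exact val_neg_neg 𝒟 _
    rw [PseudoRiemannianMetric.speed_eq_sqrt_neg_of_nonpos (by rw [hneg]; linarith)]
    exact Real.sqrt_le_sqrt (by rw [hneg]; linarith)
  -- the fixed endpoint `q₀ = Ψ(s₀, y)` and the bound on the time separation to it
  set s₀ : ℝ := τ₁ + 1 with hs₀
  set q₀ : 𝒟.carrier := Ψ (σ s₀) with hq₀
  obtain ⟨Bd, hBd, hBle⟩ := TrappedSet.exists_lorentzDist_le_of_isCompact 𝒟 (isCompact_singleton (x := q₀))
  set c₀ : ℝ := Real.sqrt (1 / 2) with hc₀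
  have hc₀pos : 0 < c₀ := Real.sqrt_pos.2 (by norm_num)
  set S : ℝ := s₀ + (Bd.toReal + 1) / c₀ with hS
  have hSs₀ : s₀ < S := lt_add_of_pos_right _ (by positivity)
  have hCa : C (-S) = Ψ (σ S) := by change Ψ (σ (-(-S))) = Ψ (σ S); rw [neg_neg]
  have hCb : C (-s₀) = q₀ := by change Ψ (σ (-(-s₀))) = Ψ (σ s₀); rw [neg_neg]
  have hlen : ENNReal.ofReal (c₀ * (-s₀ - -S)) ≤ 𝒟.metric.arcLength C (-S) (-s₀) :=
    ofReal_mul_sub_le_arcLength hc₀pos.le fun t ht ↦ hspeed t (by linarith [ht.2])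
  have hdist : 𝒟.metric.arcLength C (-S) (-s₀) ≤ 𝒟.toSpacetime.lorentzDist (Ψ (σ S)) q₀ :=
    LorentzianMetric.arcLength_le_lorentzDist (by linarith)
      ((hcurve (-S) (-s₀) (by rw [neg_neg]; linarith)).isFutureCausalCurveOn) hCa hCb
  have hbound : 𝒟.toSpacetime.lorentzDist (Ψ (σ S)) q₀ ≤ Bd :=
    hBle _ (hO _ (hσ_time S (by linarith))) q₀ (mem_singleton q₀)
  have h1 : c₀ * (-s₀ - -S) = Bd.toReal + 1 := by rw [hS]; field_simp; ring
  have h2 : Bd < ENNReal.ofReal (c₀ * (-s₀ - -S)) :=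
    h1 ▸ (ENNReal.lt_ofReal_iff_toReal_lt hBd.ne).2 (by linarith)
  exact absurd (hlen.trans (hdist.trans hbound)) (not_le.2 h2)

/-- **Clause (iii) of `IsFutureOriented` is automatic for hole-free decompositions of regions `O ⊆ J⁺(ι X)`,
in EVERY Cauchy development**: eventually in flat time, `dΨ₀(∂₀)` is future-directed at every point of the flat
slab (uniform timelikeness from `C⁰` slab convergence; SOME late point is future-directed by
`not_forall_isPastDirected_of_lateHalfSpace`; one sign on the connected pinched piece `{x⁰ > τ₁}`).
[cite: ONeillSemiRiemannian1983, Ch. 5, Lemma 5.26 ff., p. 145] [cite: arXiv08110354, §5.1] -/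
theorem flatChart_eventually_isFutureDirected (𝒟 : CauchyDevelopment D) {O : Set 𝒟.carrier} {k : ℕ}
    (d : FinalStateDecomposition 𝒟.toSpacetime O k) (hN : d.N = 0)
    (hO : O ⊆ 𝒟.metric.causalFuture 𝒟.timeOrientation (range 𝒟.embed)) :
    ∀ᶠ τ in atTop, ∀ x ∈ (Minkowski.backgroundOn d.flatDomain).timeSlab τ,
      𝒟.timeOrientation.IsFutureDirected
        (mfderiv 𝓘(ℝ, E4) (𝓡 4) d.flatChart x (E4.basisVector 0)) := by
  set u : E4 := E4.basisVector 0 with hu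
  set ε : ℝ := 1 / (2 * (‖u‖ ^ 2 + 1)) with hε
  have hεpos : 0 < ε := by positivity
  have hε1 : ε < 1 := by rw [hε, div_lt_one (by positivity)]; nlinarith [sq_nonneg ‖u‖]
  -- a time `τ₁ > τ₀` from which on the slab deviation is `< ε`; late points lie in the flat domain (`N = 0`)
  obtain ⟨τ₁, hτ₁⟩ := eventually_atTop.1
    ((d.tendsto_deviationCk_flat.eventually (gt_mem_nhds (ENNReal.ofReal_pos.2 hεpos))).and
      (eventually_gt_atTop d.τ₀))
  have hdom : ∀ z : E4, τ₁ ≤ z 0 → z ∈ (d.flatDomain : Set E4) := fun z hz ↦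
    d.lateRegion_subset_flatDomain_of_N_eq_zero hN (show d.τ₀ < z 0 from (hτ₁ τ₁ le_rfl).2.trans_le hz)
  -- point control, uniform timelike bound, causality of `dΨ₀(∂₀)` from time `τ₁` on
  have hdev : ∀ x : d.flatDomain, τ₁ ≤ (x : E4) 0 →
      ‖𝒟.toSpacetime.deviation (Minkowski.backgroundOn d.flatDomain) d.flatChart x‖ < ε := by
    intro x hx
    exact norm_deviation_lt_of_deviationCk_lt 𝒟.toSpacetime (B := Minkowski.backgroundOn d.flatDomain)
      d.flatChart (k := k) hεpos (hτ₁ ((x : E4) 0) hx).1 ((ModelBackground.mem_timeSlab).2 rfl)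
  have htl : ∀ x : d.flatDomain, τ₁ ≤ (x : E4) 0 →
      𝒟.metric.val (d.flatChart x) (mfderiv 𝓘(ℝ, E4) (𝓡 4) d.flatChart x u)
        (mfderiv 𝓘(ℝ, E4) (𝓡 4) d.flatChart x u) ≤ -(1 / 2) :=
    fun x hx ↦ metric_mfderiv_basisVector_le 𝒟.toSpacetime (V := d.flatDomain) d.flatChart x (hdev x hx).le
  have hΨd : ∀ x : d.flatDomain, MDifferentiableAt 𝓘(ℝ, E4) (𝓡 4) d.flatChart x := fun x ↦
    (d.isLateChart_flat.contMDiff x).mdifferentiableAt (by simp)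
  have hcausal : ∀ x : d.flatDomain, τ₁ ≤ (x : E4) 0 →
      𝒟.metric.IsCausal (mfderiv 𝓘(ℝ, E4) (𝓡 4) d.flatChart x u) := by
    intro x hx
    refine ⟨(htl x hx).trans (by norm_num), fun h0 ↦ ?_⟩
    have h := htl x hx
    rw [h0, map_zero] at h
    exact absurd h (by norm_num)
  -- SOME late point has a future-directed `dΨ₀(∂₀)`; then one sign on the connected pinched piece `{x⁰ > τ₁}`
  have hkey : ∃ z : d.flatDomain, τ₁ < (z : E4) 0 ∧
      𝒟.timeOrientation.IsFutureDirected (mfderiv 𝓘(ℝ, E4) (𝓡 4) d.flatChart z u) := by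
    by_contra hcon
    refine not_forall_isPastDirected_of_lateHalfSpace 𝒟 d.flatChart hΨd hdom (fun x hx ↦ hO ?_) htl ?_
    · exact d.isLateChart_flat.image_subset (mem_image_of_mem _
        (show x ∈ (Minkowski.backgroundOn d.flatDomain).lateRegion d.τ₀ from
          (ModelBackground.mem_lateRegion).2 ((hτ₁ τ₁ le_rfl).2.trans hx)))
    · exact fun z hz ↦
        (𝒟.timeOrientation.isFutureDirected_or_isPastDirected_of_isCausal (hcausal z hz.le)).resolve_left
          fun hf ↦ hcon ⟨z, hz, hf⟩
  obtain ⟨z₁, hz₁, hfut₁⟩ := hkey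
  have hWo : IsOpen {z : E4 | τ₁ < z 0} := isOpen_lt continuous_const (EuclideanSpace.proj (0 : Fin 4)).continuous
  have hWpre : IsPreconnected {z : E4 | τ₁ < z 0} :=
    (convex_halfSpace_gt (EuclideanSpace.proj (0 : Fin 4) : E4 →L[ℝ] ℝ).toLinearMap.isLinear τ₁).isPreconnected
  have hpin : ∀ z ∈ {z : E4 | τ₁ < z 0},
      ‖𝒟.toSpacetime.deviationExtend (Minkowski.backgroundOn d.flatDomain) d.flatChart z‖ < 1 := by
    intro z hz
    have hz' : z ∈ (d.flatDomain : Set E4) := hdom z (le_of_lt hz)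
    have hcoe := 𝒟.toSpacetime.deviationExtend_coe (Minkowski.backgroundOn d.flatDomain) d.flatChart ⟨z, hz'⟩
    rw [hcoe]
    exact (hdev ⟨z, hz'⟩ (le_of_lt hz)).trans hε1
  refine eventually_atTop.2 ⟨τ₁ + 1, fun τ hτ x hx ↦ ?_⟩
  have hxt : (x : E4) 0 = τ := (ModelBackground.mem_timeSlab).1 hx
  exact 𝒟.toSpacetime.isFutureDirected_mfderiv_basisVector_zero_of_isPreconnected_of_contMDiffOn
    d.flatChart hWo (fun z hz ↦ hdom z (le_of_lt hz)) d.isLateChart_flat.contMDiff.contMDiffOn hpin hWpre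
    subset_rfl hz₁ hfut₁ x (show τ₁ < (x : E4) 0 by rw [hxt]; linarith)

/-! ### §3 `IsFutureOriented` on the dispersive branch of T -/

/-- **`IsFutureOriented` is automatic for hole-free decompositions of regions in `J⁺(ι X)`**, in every Cauchy
development (the hole clauses are over `Fin 0`). [cite: arXiv08110354, §5.1] -/
theorem isFutureOriented_of_N_eq_zero (𝒟 : CauchyDevelopment D) {O : Set 𝒟.carrier} {k : ℕ}
    (d : FinalStateDecomposition 𝒟.toSpacetime O k) (hN : d.N = 0)
    (hO : O ⊆ 𝒟.metric.causalFuture 𝒟.timeOrientation (range 𝒟.embed)) :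
    _root_.Summit.FinalStateConjecture.IsFutureOriented d := by
  haveI : IsEmpty (Fin d.N) := hN ▸ Fin.isEmpty'
  exact ⟨fun i ↦ isEmptyElim i, fun i ↦ isEmptyElim i, flatChart_eventually_isFutureDirected 𝒟 d hN hO⟩

/-- **… in particular for every HONEST hole-free decomposition** (`O = exteriorOf 𝒟 d.charted ⊆ J⁺(ι X)`):
given honesty, orientation is free on the dispersive branch. [cite: DafermosLuk2017, Conjecture 1] -/
theorem isFutureOriented_of_N_eq_zero_of_exteriorOf (𝒟 : CauchyDevelopment D) {O : Set 𝒟.carrier}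
    {k : ℕ} (d : FinalStateDecomposition 𝒟.toSpacetime O k) (hN : d.N = 0)
    (hO : O = _root_.Summit.FinalStateConjecture.exteriorOf 𝒟 d.charted) :
    _root_.Summit.FinalStateConjecture.IsFutureOriented d := by
  refine isFutureOriented_of_N_eq_zero 𝒟 d hN fun q hq ↦ ?_
  rw [hO] at hq
  exact hq.1

end Development

/-! ### §4 No dust at `N = 0`: the flat slab is the entire hyperplane -/

section NoDust
variable {𝓢 : Spacetime.{u} 4} {O : Set 𝓢.carrier} {k : ℕ}

/-- **At `N = 0` every late flat slab is the entire hyperplane `{x⁰ = τ} ≅ ℝ³`** (`τ > τ₀`; no flat chart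
"placed far out" or "made of pieces" discharges the radiation-zone clause). [cite: ChristodoulouKlainerman1993, Thm. 1.0.2] -/
theorem image_timeSlab_eq_of_N_eq_zero (d : FinalStateDecomposition 𝓢 O k) (hN : d.N = 0) {τ : ℝ}
    (hτ : d.τ₀ < τ) :
    Subtype.val '' (Minkowski.backgroundOn d.flatDomain).timeSlab τ = Minkowski.timeSlab τ := by
  ext x
  simp only [mem_image, ModelBackground.mem_timeSlab, Minkowski.timeSlab, mem_setOf_eq]
  constructor
  · rintro ⟨z, hz, rfl⟩
    exact hz
  · intro hx
    exact ⟨⟨x, d.lateRegion_subset_flatDomain_of_N_eq_zero hN (show d.τ₀ < x 0 by rw [hx]; exact hτ)⟩,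
      hx, rfl⟩

/-- **… so at `N = 0` the radiation-zone clause is the `Cᵏ` sup of `Ψ₀^*g − η` over the ENTIRE hyperplane**
(`τ > τ₀`): the target needs a quasi-flat Minkowski half-space inside the region. [cite: ChristodoulouKlainerman1993, Thm. 1.0.2] -/
theorem deviationCk_flat_eq_of_N_eq_zero (d : FinalStateDecomposition 𝓢 O k) (hN : d.N = 0) {τ : ℝ}
    (hτ : d.τ₀ < τ) :
    𝓢.deviationCk (Minkowski.backgroundOn d.flatDomain) d.flatChart k τ =
      supCkENorm (Minkowski.timeSlab τ) k
        (𝓢.deviationExtend (Minkowski.backgroundOn d.flatDomain) d.flatChart) := by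
  rw [Spacetime.deviationCk, image_timeSlab_eq_of_N_eq_zero d hN hτ]

end NoDust

/-! ### §5 Hypothesis (a) of T has content iff the outer region is nonempty -/

section OuterRegion
variable {X : Type} [TopologicalSpace X] [ChartedSpace E3 X] [IsManifold (𝓡 3) ∞ X]
  [ConnectedSpace X] {D : InitialDataSet (𝓡 3) X}

/-- **Future-escaping sequences exist iff the outer region is nonempty** (⇐: sample the continuous
future-escaping outer path of `exists_isFutureEscapingPath`, p118990, at `n : ℕ`). So hypothesis (a)
`OuterHullExists` of T produces a silent hull element iff ONE outer point exists.
[cite: ONeillSemiRiemannian1983, Ch. 14, Cor. 14.1 (p. 402) and Lemma 14.6 (p. 404)] -/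
theorem exists_isFutureEscaping_iff_outerRegion_nonempty (𝒟 : VacuumCauchyDevelopment D)
    [𝒟.metric.HasLeviCivita] :
    (∃ q : ℕ → 𝒟.carrier, IsFutureEscaping 𝒟 q) ↔ (outerRegion 𝒟).Nonempty := by
  refine ⟨fun ⟨q, hq⟩ ↦ ⟨q 0, hq.1 0⟩, fun ⟨q, hq⟩ ↦ ?_⟩
  obtain ⟨γ, -, hγ, -⟩ := exists_isFutureEscapingPath 𝒟 hq
  exact ⟨fun n ↦ γ n, hγ.seq tendsto_natCast_atTop_atTop⟩

/-- **The degenerate fibre**: no future-escaping sequence exists iff the outer region is empty (there T's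
hypotheses (a)–(d) are vacuous and T owes its target from `DevHyp` alone). [folklore] -/
theorem forall_not_isFutureEscaping_iff_outerRegion_eq_empty (𝒟 : VacuumCauchyDevelopment D)
    [𝒟.metric.HasLeviCivita] :
    (∀ q : ℕ → 𝒟.carrier, ¬ IsFutureEscaping 𝒟 q) ↔ outerRegion 𝒟 = ∅ := by
  rw [← not_nonempty_iff_eq_empty, ← exists_isFutureEscaping_iff_outerRegion_nonempty, not_exists]

end OuterRegion

/-- **Registered sub-goal `stub_tameEndgame_closedPieces` of `stub_tameEndgame` (T), line `dark-future-exactness`**: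
(1) `IsFutureOriented` is automatic for hole-free decompositions of regions `O ⊆ J⁺(ι X)` in every Cauchy development;
(2) hence T's K2R♭ target on the dispersive branch is the pre-T2 target `O = exteriorOf ∧ HasExhaustiveCharts`;
(3) no dust at `N = 0` (late flat slabs are entire hyperplanes); (4) future-escaping sequences exist iff the outer
region is nonempty (content of hypothesis (a)). [cite: DafermosLuk2017, Conjecture 1] -/
theorem stub_tameEndgame_closedPieces : (∀ {X : Type} [TopologicalSpace X] [ChartedSpace E3 X] [IsManifold (𝓡 3) ∞ X] [ConnectedSpace X] {D : InitialDataSet (𝓡 3) X} (𝒟 : CauchyDevelopment D) {O : Set 𝒟.carrier} {k : ℕ} (d : FinalStateDecomposition 𝒟.toSpacetime O k), d.N = 0 → O ⊆ 𝒟.metric.causalFuture 𝒟.timeOrientation (Set.range 𝒟.embed) → _root_.Summit.FinalStateConjecture.IsFutureOriented d) ∧ (∀ {X : Type} [TopologicalSpace X] [ChartedSpace E3 X] [IsManifold (𝓡 3) ∞ X] [ConnectedSpace X] {D : InitialDataSet (𝓡 3) X} (𝒟 : VacuumCauchyDevelopment D) {O : Set 𝒟.carrier} (d : FinalStateDecomposition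 𝒟.toSpacetime O 2), d.N = 0 → O = _root_.Summit.FinalStateConjecture.exteriorOf 𝒟.toCauchyDevelopment d.charted → _root_.Summit.FinalStateConjecture.HasExhaustiveCharts d → ∃ (O : Set 𝒟.carrier) (d : FinalStateDecomposition 𝒟.toSpacetime O 2), O = _root_.Summit.FinalStateConjecture.exteriorOf 𝒟.toCauchyDevelopment d.charted ∧ _root_.Summit.FinalStateConjecture.HasExhaustiveCharts d ∧ _root_.Summit.FinalStateConjecture.IsFutureOriented d) ∧ (∀ {𝓢 : Spacetime.{0} 4} {O : Set 𝓢.carrier} {k : ℕ} (d : FinalStateDecomposition 𝓢 O k), d.N = 0 → ∀ τ : ℝ, d.τ₀ < τ → Subtype.val '' (Minkowski.backgroundOn d.flatDomain).timeSlab τ = Minkowski.timeSlab τ) ∧ ∀ {X : Type} [TopologicalSpace X] [ChartedSpace E3 X] [IsManifold (𝓡 3) ∞ X] [ConnectedSpace X] {D : InitialDataSet (𝓡 3) X} (𝒟 : VacuumCauchyDevelopment D) [𝒟.metric.HasLeviCivita], (∃ q : ℕ → 𝒟.carrier, IsFutureEscaping 𝒟 q) ↔ (outerRegion 𝒟).Nonempty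 :=
  ⟨fun 𝒟 _ _ d hN hO ↦ isFutureOriented_of_N_eq_zero 𝒟 d hN hO,
    fun 𝒟 O d hN hO hex ↦ ⟨O, d, hO, hex, isFutureOriented_of_N_eq_zero_of_exteriorOf 𝒟.toCauchyDevelopment d hN hO⟩,
    fun d hN _ hτ ↦ image_timeSlab_eq_of_N_eq_zero d hN hτ,
    fun 𝒟 _ ↦ exists_isFutureEscaping_iff_outerRegion_nonempty 𝒟⟩

end Summit.FinalStateConjecture.FinalStateConjecture.Theorems.DarkFuture

end
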